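import Mathlib.Analysis.SpecialFunctions.Pow.Real
import Mathlib.Analysis.SpecialFunctions.Exp
import Mathlib.Analysis.Real.Sqrt
import HarnessLib

/-!
# Scalar inequalities behind parabolic smoothing of the similarity heat semigroup

Analysis/OperatorTheory support file (theorems only, no definitions, no named facts): the
elementary bounds used to estimate `‖∇ e^{τ𝓛}‖ ≲ (1 − e^{−τ})^{−1/2} e^{ωτ}` on the Fourier side
and the integrability of the singularity at `τ = 0`, as in the classical heat-kernel gradient
bound `‖∇e^{tΔ}‖_{L²→L²} ≤ C t^{−1/2}` (Jia–Šverák 2015, §2; Albritton–Brué–Colombo 2022,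
Lemma 2.3 / §4.1 "parabolic regularity"):

* `le_exp_sq_div_two`: `x ≤ e^{x²/2}`;
* `mul_exp_neg_mul_sq_le`: `r e^{−a r²} ≤ (√(2a))⁻¹` for `a > 0` (maximum of the
  Gaussian-weighted linear symbol `|k| e^{−a|k|²}`);
* `sqrt_inv_one_sub_exp_neg_le`: `(√(1 − e^{−t}))⁻¹ ≤ 1 + (√t)⁻¹` for `t > 0`.

## References

* H. Jia, V. Šverák, J. Funct. Anal. 268 (2015), §2 (smoothing of `e^{τ𝓛}`). [JiaSverak2015]
* D. Albritton, E. Brué, M. Colombo, Ann. of Math. 196 (2022), §2.3 Lemma 2.3, §4.1.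
  [AlbrittonBrueColombo2022AnnMath]
-/

noncomputable section

open Real

namespace Literature.Analysis.OperatorTheory

/-- `x ≤ e^{x²/2}` for all real `x` (`x ≤ 1 + x²/2 ≤ e^{x²/2}`). [folklore] -/
theorem le_exp_sq_div_two (x : ℝ) : x ≤ Real.exp (x ^ 2 / 2) := by
  have h1 : x ≤ x ^ 2 / 2 + 1 := by nlinarith [sq_nonneg (x - 1)]
  exact h1.trans (Real.add_one_le_exp (x ^ 2 / 2))

/-- **`r e^{−a r²} ≤ (√(2a))⁻¹`** for `a > 0` (all real `r`). [folklore] -/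
theorem mul_exp_neg_mul_sq_le {a : ℝ} (ha : 0 < a) (r : ℝ) :
    r * Real.exp (-(a * r ^ 2)) ≤ (Real.sqrt (2 * a))⁻¹ := by
  have h2a : 0 < 2 * a := by linarith
  set s : ℝ := Real.sqrt (2 * a) with hs
  have hs0 : 0 < s := Real.sqrt_pos.2 h2a
  have hss : s ^ 2 = 2 * a := by rw [hs, Real.sq_sqrt h2a.le]
  -- `r s ≤ e^{(rs)²/2} = e^{a r²}`
  have key : r * s ≤ Real.exp (a * r ^ 2) := by
    refine (le_exp_sq_div_two (r * s)).trans (le_of_eq ?_)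
    congr 1
    rw [mul_pow, hss]; ring
  have hexp : 0 < Real.exp (-(a * r ^ 2)) := Real.exp_pos _
  calc r * Real.exp (-(a * r ^ 2)) = (r * s) * (Real.exp (-(a * r ^ 2)) / s) := by
        field_simp
    _ ≤ Real.exp (a * r ^ 2) * (Real.exp (-(a * r ^ 2)) / s) :=
        mul_le_mul_of_nonneg_right key (by positivity)
    _ = s⁻¹ := by
        rw [Real.exp_neg]
        field_simp

/-- **`(√(1 − e^{−t}))⁻¹ ≤ 1 + (√t)⁻¹`** for `t > 0`: the singularity of the parabolic smoothing
factor at `t = 0` is `t^{−1/2}`, integrable. [folklore] -/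
theorem sqrt_inv_one_sub_exp_neg_le {t : ℝ} (ht : 0 < t) :
    (Real.sqrt (1 - Real.exp (-t)))⁻¹ ≤ 1 + (Real.sqrt t)⁻¹ := by
  have hq : 0 < t / (1 + t) := by positivity
  -- `t/(1+t) ≤ 1 − e^{−t}` (from `1 + t ≤ e^t`; also in the tree as
  -- `Literature.Analysis.Complex.div_one_add_le_one_sub_exp_neg`, not imported to keep this file light)
  have hle : t / (1 + t) ≤ 1 - Real.exp (-t) := by
    have h1 : Real.exp (-t) ≤ (1 + t)⁻¹ := by
      rw [Real.exp_neg]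
      exact inv_anti₀ (by linarith) (by linarith [Real.add_one_le_exp t])
    have h2 : t / (1 + t) = 1 - (1 + t)⁻¹ := by
      field_simp
      ring
    rw [h2]
    linarith
  -- `(√(1 − e^{−t}))⁻¹ ≤ (√(t/(1+t)))⁻¹ = √((1+t)/t) = √(1 + 1/t) ≤ 1 + √(1/t)`
  calc (Real.sqrt (1 - Real.exp (-t)))⁻¹ ≤ (Real.sqrt (t / (1 + t)))⁻¹ :=
        inv_anti₀ (Real.sqrt_pos.2 hq) (Real.sqrt_le_sqrt hle)
    _ = Real.sqrt (1 + t⁻¹) := by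
        rw [← Real.sqrt_inv, inv_div, add_div, div_self ht.ne', one_div, add_comm]
    _ ≤ 1 + (Real.sqrt t)⁻¹ := by
        rw [Real.sqrt_le_left (by positivity), ← Real.sqrt_inv]
        have h0 : 0 ≤ Real.sqrt t⁻¹ := Real.sqrt_nonneg _
        nlinarith [Real.sq_sqrt (inv_nonneg.2 ht.le)]

end Literature.Analysis.OperatorTheory
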